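import Summits.Ventures.LatticeQCDFlow.Scoring.NonabelianAreaLaw2DPeeling
import Summits.Ventures.LatticeQCDFlow.Scoring.ProductHaarLinkSets
import Summits.Ventures.LatticeQCDFlow.Scoring.FreeBoundaryIndependence2D
import HarnessLib

/-!
# The exact non-abelian area law in two dimensions, VIII-r: local observables a ROW apart are exactly independent under the free-boundary measure

HONEST FRAMING: exact (Metropolis-corrected) sampling algorithms for lattice gauge theory;
figures of merit are autocorrelation/cost numbers at stated couplings and volumes; no
continuum-physics claim.

Venture `LatticeQCDFlow` (cell pub-lqcd), sub-topic `Scoring`; FANOUT row 5 (`s0-sun-a`), GEN-22.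
NEW WORK of the cell (placement rule).  The row twin of part VIII (`FreeBoundaryIndependence2D`, column gap),
needed because the sequel `TorusClustering2D` must handle lattice translations in BOTH directions (the two
statements are not exchanged by a symmetry available for a general continuous matrix representation: transposing
the lattice inverts every plaquette holonomy).  Every compact second-countable `G`, every continuous weight `w`.

* §1 **`integral_mul_prod_rect_of_forall_row`** — ROW-LOCAL PEELING: if `Φ` ignores every vertical link of the
  rows `j + b`, `b < T`, the `R₀ × T` block with corner `(i, j)` integrates out,
  `∫ Φ ∏_{p∈B} w(U_p) = (∫ w)^{R₀ T} ∫ Φ` (columns peeled right-to-left through their right links, part IV-a's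
  `integral_prod_words_mul`).
* §2 bookkeeping: the links of a block's plaquettes lie in the block's rows (`snd_one_of_mem_blockLinks`,
  `blockLinks_ne_vert`), blocks a row apart have disjoint link sets (`blockLinks_disjoint_of_row_gap`), row
  splitting `prod_rect_add_rows`.
* §3 **`integral_mul_mul_prod_weight_eq_of_row_gap`** — in `Reg = R₀ × (c₁ + k + T₂)` with corner `(i, j)`
  (`0 < k`), if `Φ₁` sees only the links of the plaquettes of the bottom sub-block `Q₁ = R₀ × c₁` and `Φ₂` only
  those of the top sub-block `Q₂ = R₀ × T₂` (corner `(i, j + c₁ + k)`), then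
  `∫ Φ₁ Φ₂ ∏_{p∈Reg} w(U_p) = (∫w)^{R₀ k} · (∫ Φ₁ ∏_{p∈Q₁} w(U_p)) · (∫ Φ₂ ∏_{p∈Q₂} w(U_p))`.

No `def`, nothing cited as a fact, 0 sorry.
-/

noncomputable section

open MeasureTheory Function Finset
open Literature.MathematicalPhysics.QuantumFieldTheory
open Literature.MathematicalPhysics.QuantumLattice
open Summit.Ventures.LatticeQCDFlow.Theory2.Lattice
open Summit.Ventures.LatticeQCDFlow.Theory2.Lattice.TwoDim

namespace Summit.Ventures.LatticeQCDFlow.Scoring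

variable {L : ℕ} [NeZero L] {G : Type*} [Group G] [TopologicalSpace G] [IsTopologicalGroup G]
  [CompactSpace G] [SecondCountableTopology G] [MeasurableSpace G] [BorelSpace G]

/-! ## §1. Row-local peeling -/

/-- **ROW-LOCAL PEELING.**  If a continuous `Φ` ignores every vertical link `(![x, j + b], 1)` of the rows
`b < T` (`0 < T`, `T + 1 ≤ L`), then for every `R₀ + 1 ≤ L` the `R₀ × T` block of plaquette weights with corner
`(i, j)` integrates out: `∫ Φ ∏_{p∈B} w(U_p) dHaar^{⊗E} = (∫ w)^{R₀ T} · ∫ Φ dHaar^{⊗E}`. -/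
theorem integral_mul_prod_rect_of_forall_row {w : G → ℝ} (hw : Continuous w) (i j : ZMod L) {T : ℕ}
    (hT0 : 0 < T) (hT : T + 1 ≤ L) {Φ : GaugeConfig 2 L G → ℂ} (hΦ : Continuous Φ)
    (hΦe : ∀ (b : ℕ) (x : ZMod L) (U : GaugeConfig 2 L G) (g : G), b < T →
      Φ (update U (![x, j + b], 1) g) = Φ U) :
    ∀ (R₀ : ℕ), R₀ + 1 ≤ L →
      ∫ U, Φ U * ∏ p ∈ (range R₀ ×ˢ range T).image (fun q : ℕ × ℕ => (![i + q.1, j + q.2] : Site 2 L)),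
          (w (plaquetteHolonomy U p 0 1) : ℂ) ∂(Measure.pi fun _ : Edge 2 L => haarProbability G) =
        (∫ g, (w g : ℂ) ∂(haarProbability G)) ^ (R₀ * T) *
          ∫ U, Φ U ∂(Measure.pi fun _ : Edge 2 L => haarProbability G) := by
  intro R₀
  induction R₀ with
  | zero => intro _; simp
  | succ R₀ ih =>
    intro hR₀
    haveI : Fact (1 < L) := ⟨by omega⟩
    have hTL : T ≤ L := by omega
    have hz2 : (i + R₀ : ZMod L) ≠ i + R₀ + 1 := fun h => one_ne_zero (left_eq_add.mp h)
    -- rows capped at `T - 1`, so that EVERY `e c` is a right link of the last column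
    let row : ℕ → ℕ := fun b => min b (T - 1)
    have hrow : ∀ b < T, row b = b := fun b hb => Nat.min_eq_left (by omega)
    have hrowT : ∀ b, row b < T := fun b => lt_of_le_of_lt (Nat.min_le_right _ _) (by omega)
    let e : ℕ → Edge 2 L := fun b => (![i + R₀ + 1, j + (row b : ℕ)], 1)
    let A : ℕ → GaugeConfig 2 L G → G := fun b U => U (![i + R₀, j + b], 0)
    let B : ℕ → GaugeConfig 2 L G → G := fun b U =>
      (U (![i + R₀, j + b + 1], 0))⁻¹ * (U (![i + R₀, j + b], 1))⁻¹
    let Ψ : GaugeConfig 2 L G → ℂ := fun U =>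
      Φ U * ∏ p ∈ (range R₀ ×ˢ range T).image (fun q : ℕ × ℕ => (![i + q.1, j + q.2] : Site 2 L)),
        (w (plaquetteHolonomy U p 0 1) : ℂ)
    have hev : ∀ e' : Edge 2 L, Continuous fun U : GaugeConfig 2 L G => U e' := fun e' => continuous_apply e'
    have he : ∀ b < T, ∀ b' < T, e b = e b' → b = b' := by
      intro b hb b' hb' h
      have h1 : (![i + R₀ + 1, j + (row b : ℕ)] : Site 2 L) = ![i + R₀ + 1, j + (row b' : ℕ)] :=
        congrArg Prod.fst h
      rw [hrow b hb, hrow b' hb'] at h1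
      have h2 := add_left_cancel (vec2_eq_iff.mp h1).2
      by_contra hne
      exact natCast_zmod_ne_of_lt (L := L) (by omega) (by omega) hne h2
    have hA : ∀ b, Continuous (A b) := fun b => hev _
    have hB : ∀ b, Continuous (B b) := fun b => by
      show Continuous fun U : GaugeConfig 2 L G =>
        (U (![i + R₀, j + b + 1], 0))⁻¹ * (U (![i + R₀, j + b], 1))⁻¹
      exact (hev ((![i + R₀, j + b + 1], 0) : Edge 2 L)).inv.mul (hev ((![i + R₀, j + b], 1) : Edge 2 L)).inv
    have hAe : ∀ b b' U g, A b (update U (e b') g) = A b U := by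
      intro b b' U g
      show update U (![i + R₀ + 1, j + (row b' : ℕ)], 1) g (![i + R₀, j + b], 0) = _
      rw [update_of_ne (fun h => absurd (congrArg Prod.snd h : (0 : Fin 2) = 1) (by decide))]
    have hBe : ∀ b b' U g, B b (update U (e b') g) = B b U := by
      intro b b' U g
      show (update U (![i + R₀ + 1, j + (row b' : ℕ)], 1) g (![i + R₀, j + b + 1], 0))⁻¹ *
          (update U (![i + R₀ + 1, j + (row b' : ℕ)], 1) g (![i + R₀, j + b], 1))⁻¹ = _
      rw [update_of_ne (fun h => absurd (congrArg Prod.snd h : (0 : Fin 2) = 1) (by decide)),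
        update_of_ne (fun h => hz2 (vec2_eq_iff.mp (congrArg Prod.fst h)).1)]
    have hΨ : Continuous Ψ :=
      hΦ.mul (continuous_finsetProd _ fun p _ =>
        Complex.continuous_ofReal.comp (hw.comp (continuous_config_plaquetteHolonomy p 0 1)))
    have hΨe : ∀ b U g, Ψ (update U (e b) g) = Ψ U := by
      intro b U g
      show Φ (update U (![i + R₀ + 1, j + (row b : ℕ)], 1) g) * _ = Φ U * _
      rw [hΦe (row b) (i + R₀ + 1) U g (hrowT b)]
      congr 1
      exact Finset.prod_congr rfl fun p hp => by
        rw [plaquetteHolonomy_update_col_of_mem_rect i j hR₀ hp]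
    have hword : ∀ b < T, ∀ (U : GaugeConfig 2 L G),
        A b U * U (e b) * B b U = plaquetteHolonomy U ![i + R₀, j + b] 0 1 := by
      intro b hb U
      simp only [A, B, e, hrow b hb, plaquetteHolonomy, shift_vec2_zero, shift_vec2_one, mul_assoc]
    have hpt : ∀ U : GaugeConfig 2 L G,
        Φ U * ∏ p ∈ (range (R₀ + 1) ×ˢ range T).image (fun q : ℕ × ℕ => (![i + q.1, j + q.2] : Site 2 L)),
            (w (plaquetteHolonomy U p 0 1) : ℂ) =
          (∏ b ∈ range T, (w (A b U * U (e b) * B b U) : ℂ)) * Ψ U := by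
      intro U
      rw [prod_rect_succ_eq i j (R := R₀) (T := T) (by omega) hTL]
      have hcol : ∏ b ∈ range T, (w (plaquetteHolonomy U ![i + R₀, j + b] 0 1) : ℂ) =
          ∏ b ∈ range T, (w (A b U * U (e b) * B b U) : ℂ) :=
        Finset.prod_congr rfl fun b hb => by rw [hword b (Finset.mem_range.mp hb)]
      rw [hcol]
      simp only [Ψ]
      ring
    simp_rw [hpt]
    rw [integral_prod_words_mul hw T e A B Ψ he hA hB hAe hBe hΨ hΨe, ih (by omega), ← mul_assoc,
      ← pow_add]
    congr 2
    ring

/-! ## §2. Bookkeeping: rows of the links of a block, row sub-blocks -/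

section Bookkeeping

omit [NeZero L] [Group G] [TopologicalSpace G] [IsTopologicalGroup G] [CompactSpace G]
  [SecondCountableTopology G] [MeasurableSpace G] [BorelSpace G] in
/-- Splitting a product over the `R × (T₁ + T₂)` block with corner `(i, j)` into the row sub-blocks `R × T₁` at
`(i, j)` and `R × T₂` at `(i, j + T₁)` (`R ≤ L`, `T₁ + T₂ ≤ L`). -/
theorem prod_rect_add_rows {M' : Type*} [CommMonoid M'] (i j : ZMod L) {R T₁ T₂ : ℕ} (hR : R ≤ L)
    (hT : T₁ + T₂ ≤ L) (f : Site 2 L → M') :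
    ∏ x ∈ (range R ×ˢ range (T₁ + T₂)).image (fun q : ℕ × ℕ => (![i + q.1, j + q.2] : Site 2 L)), f x =
      (∏ x ∈ (range R ×ˢ range T₁).image (fun q : ℕ × ℕ => (![i + q.1, j + q.2] : Site 2 L)), f x) *
        ∏ x ∈ (range R ×ˢ range T₂).image (fun q : ℕ × ℕ => (![i + q.1, j + T₁ + q.2] : Site 2 L)), f x := by
  rw [prod_rect_eq i j hR hT, prod_rect_eq i j hR (by omega), prod_rect_eq i (j + (T₁ : ZMod L)) hR (by omega),
    Finset.prod_range_add]
  congr 1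
  refine Finset.prod_congr rfl fun b _ => Finset.prod_congr rfl fun a _ => ?_
  rw [show (j : ZMod L) + ((T₁ + b : ℕ) : ZMod L) = j + T₁ + (b : ZMod L) by push_cast; ring]

omit [NeZero L] in
/-- **The links of the plaquettes of a block lie in the block's rows.**  If `e` is one of the four links of a
plaquette of the `R × T` block with corner `(i, j)`, its base site has second coordinate `j + m`, `m ≤ T`, with
`m < T` when `e` is vertical. -/
theorem snd_one_of_mem_blockLinks [NeZero L] (i j : ZMod L) {R T : ℕ} {e : Edge 2 L} {p : Site 2 L}
    (hp : p ∈ (range R ×ˢ range T).image (fun q : ℕ × ℕ => (![i + q.1, j + q.2] : Site 2 L)))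
    (he : ((p, 0) : Edge 2 L) = e ∨ ((p.shift 0, 1) : Edge 2 L) = e ∨ ((p.shift 1, 0) : Edge 2 L) = e ∨
      ((p, 1) : Edge 2 L) = e) :
    ∃ m : ℕ, m ≤ T ∧ e.1 1 = j + m ∧ (e.2 = 1 → m < T) := by
  obtain ⟨⟨a, b⟩, hq, rfl⟩ := Finset.mem_image.mp hp
  rw [Finset.mem_product, Finset.mem_range, Finset.mem_range] at hq
  rcases he with h | h | h | h <;> subst h
  · exact ⟨b, by omega, by simp, fun h => by simp at h⟩
  · exact ⟨b, by omega, by simp [shift_vec2_zero], fun _ => hq.2⟩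
  · refine ⟨b + 1, by omega, ?_, fun h => by simp at h⟩
    simp [add_assoc]
  · exact ⟨b, by omega, by simp, fun _ => hq.2⟩

omit [NeZero L] in
/-- A vertical link in a row OUTSIDE a block's rows is none of the links of the block's plaquettes: block
`R × T` with corner `(i, j')`, `j' = j + n₀`, link `(![x, j + n], 1)` with `n < n₀` or `n₀ + T ≤ n`. -/
theorem blockLinks_ne_vert [NeZero L] (i j j' : ZMod L) {n₀ R T : ℕ} (hj' : j' = j + n₀) {p : Site 2 L}
    (hp : p ∈ (range R ×ˢ range T).image (fun q : ℕ × ℕ => (![i + q.1, j' + q.2] : Site 2 L)))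
    {n : ℕ} (hn : n < n₀ ∨ n₀ + T ≤ n) (hnL : n < L) (hTL : n₀ + T ≤ L) (x : ZMod L) :
    ((p, 0) : Edge 2 L) ≠ (![x, j + n], 1) ∧ ((p.shift 0, 1) : Edge 2 L) ≠ (![x, j + n], 1) ∧
      ((p.shift 1, 0) : Edge 2 L) ≠ (![x, j + n], 1) ∧ ((p, 1) : Edge 2 L) ≠ (![x, j + n], 1) := by
  have h : ¬ (((p, 0) : Edge 2 L) = (![x, j + n], 1) ∨ ((p.shift 0, 1) : Edge 2 L) = (![x, j + n], 1) ∨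
      ((p.shift 1, 0) : Edge 2 L) = (![x, j + n], 1) ∨ ((p, 1) : Edge 2 L) = (![x, j + n], 1)) := by
    intro h'
    subst hj'
    obtain ⟨m, hm, h0, hlt⟩ := snd_one_of_mem_blockLinks i (j + (n₀ : ZMod L)) hp h'
    have hmT : m < T := hlt rfl
    have h1 : ((n : ℕ) : ZMod L) = ((n₀ + m : ℕ) : ZMod L) := by
      have h0' : (j : ZMod L) + n = j + n₀ + m := by simpa using h0
      push_cast
      linear_combination h0'
    exact natCast_zmod_ne_of_lt (L := L) hnL (by omega) (by omega) h1
  simp only [not_or] at h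
  exact ⟨h.1, h.2.1, h.2.2.1, h.2.2.2⟩

omit [NeZero L] in
/-- **Blocks a row apart have disjoint link sets.**  A link of a plaquette of the `R × c₁` block with corner
`(i, j)` is not a link of a plaquette of the `R' × T₂` block with corner `(i', j + c₁ + k)` when `0 < k` and
`c₁ + k + T₂ + 1 ≤ L`. -/
theorem blockLinks_disjoint_of_row_gap [NeZero L] (i i' j : ZMod L) {c₁ k T₂ R R' : ℕ} (hk : 0 < k)
    (hfit : c₁ + k + T₂ + 1 ≤ L) {e : Edge 2 L} {p₁ p₂ : Site 2 L}
    (hp₁ : p₁ ∈ (range R ×ˢ range c₁).image (fun q : ℕ × ℕ => (![i + q.1, j + q.2] : Site 2 L)))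
    (hp₂ : p₂ ∈ (range R' ×ˢ range T₂).image (fun q : ℕ × ℕ => (![i' + q.1, j + c₁ + k + q.2] : Site 2 L)))
    (he₁ : ((p₁, 0) : Edge 2 L) = e ∨ ((p₁.shift 0, 1) : Edge 2 L) = e ∨ ((p₁.shift 1, 0) : Edge 2 L) = e ∨
      ((p₁, 1) : Edge 2 L) = e) :
    ¬ (((p₂, 0) : Edge 2 L) = e ∨ ((p₂.shift 0, 1) : Edge 2 L) = e ∨ ((p₂.shift 1, 0) : Edge 2 L) = e ∨
      ((p₂, 1) : Edge 2 L) = e) := by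
  intro he₂
  obtain ⟨m₁, hm₁, h₁, -⟩ := snd_one_of_mem_blockLinks i j hp₁ he₁
  obtain ⟨m₂, hm₂, h₂, -⟩ :=
    snd_one_of_mem_blockLinks i' (j + (c₁ : ZMod L) + (k : ZMod L)) hp₂ he₂
  have h₃ : ((m₁ : ℕ) : ZMod L) = ((c₁ + k + m₂ : ℕ) : ZMod L) := by
    have h := h₁.symm.trans h₂
    push_cast
    linear_combination h
  exact natCast_zmod_ne_of_lt (L := L) (by omega) (by omega) (by omega) h₃


end Bookkeeping

/-! ## §3. Two local observables a row apart are exactly independent -/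

section Independence

/-- **THE PRODUCT FORMULA FOR ROW-SEPARATED OBSERVABLES.**  `Reg = R₀ × (c₁ + k + T₂)` at `(i, j)`
(`c₁ + k + T₂ + 1 ≤ L`, `R₀ + 1 ≤ L`, `0 < k`); `Φ₁` continuous, seeing only the links of the plaquettes of
`Q₁ = R₀ × c₁` at `(i, j)`; `Φ₂` continuous, seeing only the links of the plaquettes of `Q₂ = R₀ × T₂` at
`(i, j + c₁ + k)`; any continuous weight `w`.  Then
`∫ Φ₁ Φ₂ ∏_{p∈Reg} w(U_p) = (∫ w)^{R₀ k} · (∫ Φ₁ ∏_{p∈Q₁} w(U_p)) · (∫ Φ₂ ∏_{p∈Q₂} w(U_p))`. -/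
theorem integral_mul_mul_prod_weight_eq_of_row_gap {w : G → ℝ} (hw : Continuous w) (i j : ZMod L)
    {c₁ k T₂ R₀ : ℕ} (hk : 0 < k) (hfit : c₁ + k + T₂ + 1 ≤ L) (hR : R₀ + 1 ≤ L)
    {Φ₁ Φ₂ : GaugeConfig 2 L G → ℂ} (hΦ₁ : Continuous Φ₁) (hΦ₂ : Continuous Φ₂)
    (hΦ₁e : ∀ (e : Edge 2 L) (U : GaugeConfig 2 L G) (g : G),
      (∀ p ∈ (range R₀ ×ˢ range c₁).image (fun q : ℕ × ℕ => (![i + q.1, j + q.2] : Site 2 L)),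
        ((p, 0) : Edge 2 L) ≠ e ∧ ((Site.shift p 0, 1) : Edge 2 L) ≠ e ∧
          ((Site.shift p 1, 0) : Edge 2 L) ≠ e ∧ ((p, 1) : Edge 2 L) ≠ e) → Φ₁ (update U e g) = Φ₁ U)
    (hΦ₂e : ∀ (e : Edge 2 L) (U : GaugeConfig 2 L G) (g : G),
      (∀ p ∈ (range R₀ ×ˢ range T₂).image (fun q : ℕ × ℕ => (![i + q.1, j + c₁ + k + q.2] : Site 2 L)),
        ((p, 0) : Edge 2 L) ≠ e ∧ ((Site.shift p 0, 1) : Edge 2 L) ≠ e ∧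
          ((Site.shift p 1, 0) : Edge 2 L) ≠ e ∧ ((p, 1) : Edge 2 L) ≠ e) → Φ₂ (update U e g) = Φ₂ U) :
    ∫ U, Φ₁ U * Φ₂ U *
        ∏ p ∈ (range R₀ ×ˢ range (c₁ + k + T₂)).image (fun q : ℕ × ℕ => (![i + q.1, j + q.2] : Site 2 L)),
          (w (plaquetteHolonomy U p 0 1) : ℂ) ∂(Measure.pi fun _ : Edge 2 L => haarProbability G) =
      (∫ g, (w g : ℂ) ∂(haarProbability G)) ^ (R₀ * k) *
        ((∫ U, Φ₁ U * ∏ p ∈ (range R₀ ×ˢ range c₁).image (fun q : ℕ × ℕ => (![i + q.1, j + q.2] : Site 2 L)),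
            (w (plaquetteHolonomy U p 0 1) : ℂ) ∂(Measure.pi fun _ : Edge 2 L => haarProbability G)) *
          ∫ U, Φ₂ U * ∏ p ∈ (range R₀ ×ˢ range T₂).image
              (fun q : ℕ × ℕ => (![i + q.1, j + c₁ + k + q.2] : Site 2 L)),
            (w (plaquetteHolonomy U p 0 1) : ℂ) ∂(Measure.pi fun _ : Edge 2 L => haarProbability G)) := by
  classical
  haveI : Fact (1 < L) := ⟨by omega⟩
  set Q₁ := (range R₀ ×ˢ range c₁).image (fun q : ℕ × ℕ => (![i + q.1, j + q.2] : Site 2 L)) with hQ₁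
  set QM := (range R₀ ×ˢ range k).image (fun q : ℕ × ℕ => (![i + q.1, j + c₁ + q.2] : Site 2 L)) with hQM
  set Q₂ := (range R₀ ×ˢ range T₂).image (fun q : ℕ × ℕ => (![i + q.1, j + c₁ + k + q.2] : Site 2 L))
    with hQ₂
  -- the block's product, split into the three row sub-blocks
  have hsplit : ∀ U : GaugeConfig 2 L G,
      ∏ p ∈ (range R₀ ×ˢ range (c₁ + k + T₂)).image (fun q : ℕ × ℕ => (![i + q.1, j + q.2] : Site 2 L)),
          (w (plaquetteHolonomy U p 0 1) : ℂ) =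
        (∏ p ∈ Q₁, (w (plaquetteHolonomy U p 0 1) : ℂ)) * ((∏ p ∈ QM, (w (plaquetteHolonomy U p 0 1) : ℂ)) *
          ∏ p ∈ Q₂, (w (plaquetteHolonomy U p 0 1) : ℂ)) := by
    intro U
    rw [show c₁ + k + T₂ = c₁ + (k + T₂) by ring,
      prod_rect_add_rows i j (T₁ := c₁) (T₂ := k + T₂) (by omega) (by omega),
      prod_rect_add_rows i (j + (c₁ : ZMod L)) (T₁ := k) (T₂ := T₂) (by omega) (by omega)]
  set Ψ : GaugeConfig 2 L G → ℂ := fun U =>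
    (Φ₁ U * ∏ p ∈ Q₁, (w (plaquetteHolonomy U p 0 1) : ℂ)) *
      (Φ₂ U * ∏ p ∈ Q₂, (w (plaquetteHolonomy U p 0 1) : ℂ)) with hΨ
  have hpt : ∀ U : GaugeConfig 2 L G,
      Φ₁ U * Φ₂ U * ∏ p ∈ (range R₀ ×ˢ range (c₁ + k + T₂)).image
          (fun q : ℕ × ℕ => (![i + q.1, j + q.2] : Site 2 L)), (w (plaquetteHolonomy U p 0 1) : ℂ) =
        Ψ U * ∏ p ∈ QM, (w (plaquetteHolonomy U p 0 1) : ℂ) := by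
    intro U; rw [hsplit U]; simp only [Ψ]; ring
  have hprodc : ∀ s : Finset (Site 2 L), Continuous fun U : GaugeConfig 2 L G =>
      ∏ p ∈ s, (w (plaquetteHolonomy U p 0 1) : ℂ) := fun s =>
    continuous_finsetProd _ fun p _ =>
      Complex.continuous_ofReal.comp (hw.comp (continuous_config_plaquetteHolonomy p 0 1))
  have hΨc : Continuous Ψ := (hΦ₁.mul (hprodc Q₁)).mul (hΦ₂.mul (hprodc Q₂))
  -- `Ψ` ignores the vertical links of the middle rows `j + c₁ + b`, `b < k`
  have hΨe : ∀ (b : ℕ) (x : ZMod L) (U : GaugeConfig 2 L G) (g : G), b < k →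
      Ψ (update U (![x, j + c₁ + b], 1) g) = Ψ U := by
    intro b x U g hb
    have hcast : (![x, j + c₁ + b] : Site 2 L) = ![x, j + ((c₁ + b : ℕ) : ZMod L)] := by
      push_cast; rw [add_assoc]
    have h₁ : ∀ p ∈ Q₁, ((p, 0) : Edge 2 L) ≠ (![x, j + c₁ + b], 1) ∧
        ((Site.shift p 0, 1) : Edge 2 L) ≠ (![x, j + c₁ + b], 1) ∧
        ((Site.shift p 1, 0) : Edge 2 L) ≠ (![x, j + c₁ + b], 1) ∧
        ((p, 1) : Edge 2 L) ≠ (![x, j + c₁ + b], 1) := by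
      intro p hp
      rw [hcast]
      exact blockLinks_ne_vert i j j (n₀ := 0) (by simp) hp (Or.inr (by omega)) (by omega) (by omega) x
    have h₂ : ∀ p ∈ Q₂, ((p, 0) : Edge 2 L) ≠ (![x, j + c₁ + b], 1) ∧
        ((Site.shift p 0, 1) : Edge 2 L) ≠ (![x, j + c₁ + b], 1) ∧
        ((Site.shift p 1, 0) : Edge 2 L) ≠ (![x, j + c₁ + b], 1) ∧
        ((p, 1) : Edge 2 L) ≠ (![x, j + c₁ + b], 1) := by
      intro p hp
      rw [hcast]
      exact blockLinks_ne_vert i j (j + (c₁ : ZMod L) + (k : ZMod L)) (n₀ := c₁ + k) (by push_cast; ring) hp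
        (Or.inl (by omega)) (by omega) (by omega) x
    have hP₁ : ∏ p ∈ Q₁, (w (plaquetteHolonomy (update U (![x, j + c₁ + b], 1) g) p 0 1) : ℂ) =
        ∏ p ∈ Q₁, (w (plaquetteHolonomy U p 0 1) : ℂ) :=
      Finset.prod_congr rfl fun p hp => by
        obtain ⟨e1, e2, e3, e4⟩ := h₁ p hp
        rw [plaquetteHolonomy_update_of_ne_links g e1 e2 e3 e4]
    have hP₂ : ∏ p ∈ Q₂, (w (plaquetteHolonomy (update U (![x, j + c₁ + b], 1) g) p 0 1) : ℂ) =
        ∏ p ∈ Q₂, (w (plaquetteHolonomy U p 0 1) : ℂ) :=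
      Finset.prod_congr rfl fun p hp => by
        obtain ⟨e1, e2, e3, e4⟩ := h₂ p hp
        rw [plaquetteHolonomy_update_of_ne_links g e1 e2 e3 e4]
    simp only [Ψ]
    rw [hΦ₁e _ U g h₁, hΦ₂e _ U g h₂, hP₁, hP₂]
  -- peel the middle block
  simp_rw [hpt]
  rw [integral_mul_prod_rect_of_forall_row hw i (j + (c₁ : ZMod L)) hk (by omega) hΨc hΨe R₀ hR]
  congr 1
  -- factorise
  let D : Finset (Edge 2 L) := Q₁.biUnion fun p =>
    {((p, 0) : Edge 2 L), ((Site.shift p 0, 1) : Edge 2 L), ((Site.shift p 1, 0) : Edge 2 L),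
      ((p, 1) : Edge 2 L)}
  have hD : ∀ e : Edge 2 L, e ∉ D → ∀ p ∈ Q₁, ((p, 0) : Edge 2 L) ≠ e ∧
      ((Site.shift p 0, 1) : Edge 2 L) ≠ e ∧ ((Site.shift p 1, 0) : Edge 2 L) ≠ e ∧
      ((p, 1) : Edge 2 L) ≠ e := by
    intro e he p hp
    simp only [D, Finset.mem_biUnion, Finset.mem_insert, Finset.mem_singleton, not_exists, not_and,
      not_or] at he
    obtain ⟨e1, e2, e3, e4⟩ := he p hp
    exact ⟨Ne.symm e1, Ne.symm e2, Ne.symm e3, Ne.symm e4⟩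
  have hD' : ∀ e : Edge 2 L, e ∈ D → ∀ p ∈ Q₂, ((p, 0) : Edge 2 L) ≠ e ∧
      ((Site.shift p 0, 1) : Edge 2 L) ≠ e ∧ ((Site.shift p 1, 0) : Edge 2 L) ≠ e ∧
      ((p, 1) : Edge 2 L) ≠ e := by
    intro e he p₂ hp₂
    simp only [D, Finset.mem_biUnion, Finset.mem_insert, Finset.mem_singleton] at he
    obtain ⟨p₁, hp₁, he₁⟩ := he
    have he₁' : ((p₁, 0) : Edge 2 L) = e ∨ ((Site.shift p₁ 0, 1) : Edge 2 L) = e ∨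
        ((Site.shift p₁ 1, 0) : Edge 2 L) = e ∨ ((p₁, 1) : Edge 2 L) = e := by
      rcases he₁ with h | h | h | h
      · exact Or.inl h.symm
      · exact Or.inr (Or.inl h.symm)
      · exact Or.inr (Or.inr (Or.inl h.symm))
      · exact Or.inr (Or.inr (Or.inr h.symm))
    have h := blockLinks_disjoint_of_row_gap i i j hk hfit hp₁ hp₂ he₁'
    simp only [not_or] at h
    exact ⟨h.1, h.2.1, h.2.2.1, h.2.2.2⟩
  refine integral_mul_eq_mul_of_forall_update (haarProbability G) D _ _ (fun e he U g => ?_)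
    (fun e he U g => ?_)
  · have h := hD e he
    show Φ₁ (update U e g) * ∏ p ∈ Q₁, (w (plaquetteHolonomy (update U e g) p 0 1) : ℂ) =
      Φ₁ U * ∏ p ∈ Q₁, (w (plaquetteHolonomy U p 0 1) : ℂ)
    rw [hΦ₁e e U g h]
    congr 1
    exact Finset.prod_congr rfl fun p hp => by
      obtain ⟨e1, e2, e3, e4⟩ := h p hp
      rw [plaquetteHolonomy_update_of_ne_links g e1 e2 e3 e4]
  · have h := hD' e he
    show Φ₂ (update U e g) * ∏ p ∈ Q₂, (w (plaquetteHolonomy (update U e g) p 0 1) : ℂ) =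
      Φ₂ U * ∏ p ∈ Q₂, (w (plaquetteHolonomy U p 0 1) : ℂ)
    rw [hΦ₂e e U g h]
    congr 1
    exact Finset.prod_congr rfl fun p hp => by
      obtain ⟨e1, e2, e3, e4⟩ := h p hp
      rw [plaquetteHolonomy_update_of_ne_links g e1 e2 e3 e4]

end Independence

end Summit.Ventures.LatticeQCDFlow.Scoring
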